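import Mathlib
import HarnessLib
import Summits.ValiantsHypothesis.ValiantsHypothesis.Theorems.LacunarySymmetroidMatrixDescartesProductPlusOneSeparatingWeightFloorCurrency
import Summits.ValiantsHypothesis.ValiantsHypothesis.Theorems.LacunarySymmetroidMatrixDescartesProductPlusOneSeparatingWeightOneSignedK

/-!
# ValiantsHypothesis / LacunarySymmetroid — crux `MatrixDescartes` (stmt-ValiantsHypothesis-18050, V1),
# LINE (A) «product_plus_one», floor `OneChangeFloorK3`: the MIXED ratio-ordered sector IN THE FLOOR'S OWN CURRENCY

Floor-currency form (general support `d 0 < d 1 < d 2`, table `a : Fin m → Fin 3 → ℝ`, `eulerNumerator d a 0` unfolded) of the mixed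
sector ✓ `sepWeight_ratioOrdered_withOneSigned` / ✓ `sepWeight_meanOrdered_mixedK_le`: companies of incoherent no-dip rows `(+,−,−)`
and one-signed rows `(+,+,+)` — both are rows of the floor (`¬(a_{j0}a_{j1} < 0 ∧ a_{j1}a_{j2} < 0)`), and together they are the second
half of its open core («incoherent rows in company with one-signed rows, any ratio»).

* ★★★ `sepWeight_ratioOrdered_mixed_floor` — if at every `x > 0`, every one-signed row `j` and every switched incoherent row `j`
  (`f_j(x) < 0`) has middle/top ratio at least that of every unswitched incoherent row `i` (`f_i(x) > 0`), `a_{i1}/a_{i2} ≤ a_{j1}/a_{j2}`,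
  then `Z₊(eulerNumerator d a 0) ≤ m + (m + 1)` — EVERY support ratio.

HONEST FRAMING: a sector of the research floor in its own currency; NOT `OneChangeFloorK3`, not `MatrixDescartes`; `VP ≠ VNP` is NOT
proved.  No definitions, no named facts, no sorry.
-/

set_option linter.dupNamespace false

namespace Summit.ValiantsHypothesis.ValiantsHypothesis.Theorems.LacunarySymmetroidMatrixDescartes

namespace ProductPlusOne

open Polynomial Finset
open scoped BigOperators

/-- ★★★ **THE MIXED RATIO-ORDERED SECTOR IN FLOOR CURRENCY** (any support `d 0 < d 1 < d 2`, bottom coupling; each row incoherent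
no-dip `a_{j0} > 0 > a_{j1}, a_{j2}` or one-signed `a_{jl} > 0`): if at every `x > 0`, for every row `j` that is one-signed or switched
incoherent and every unswitched incoherent row `i`, `a_{i1}/a_{i2} ≤ a_{j1}/a_{j2}`, then `Z₊(eulerNumerator d a 0) ≤ m + (m + 1)`.
[this file's theorem] -/
theorem sepWeight_ratioOrdered_mixed_floor {m : ℕ} (d : Fin 3 → ℕ) (h01 : d 0 < d 1) (h12 : d 1 < d 2) (a : Fin m → Fin 3 → ℝ)
    (hrows : ∀ j, (0 < a j 0 ∧ a j 1 < 0 ∧ a j 2 < 0) ∨ (0 < a j 0 ∧ 0 < a j 1 ∧ 0 < a j 2))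
    (hord : ∀ x : ℝ, 0 < x → ∀ j i,
      ((0 < a j 1 ∧ 0 < a j 2) ∨ a j 0 * x ^ (d 0) + a j 1 * x ^ (d 1) + a j 2 * x ^ (d 2) < 0) →
      (a i 1 < 0 ∧ a i 2 < 0) → 0 < a i 0 * x ^ (d 0) + a i 1 * x ^ (d 1) + a i 2 * x ^ (d 2) →
      a i 1 / a i 2 ≤ a j 1 / a j 2) :
    ((∑ j, (∑ l, C (a j l * ((d l : ℝ) - d 0)) * X ^ (d l)) * ∏ i ∈ Finset.univ.erase j, (∑ l, C (a i l) * X ^ (d l))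
        : ℝ[X]).roots.toFinset.filter (fun t => 0 < t)).card ≤ m + (m + 1) := by
  classical
  have h02 : d 0 < d 2 := h01.trans h12
  have hd : ∀ l : Fin 3, l ≠ 0 → d 0 < d l := by
    intro l hl
    fin_cases l
    · exact absurd rfl hl
    · exact h01
    · exact h02
  have hK : ∃ l : Fin 3, l ≠ 0 := ⟨1, by decide⟩
  have hrows' : ∀ j, (0 < a j 0 ∧ ∀ l : Fin 3, l ≠ 0 → a j l < 0) ∨ (∀ l, 0 < a j l) := by
    intro j
    rcases hrows j with h | h
    · refine Or.inl ⟨h.1, fun l hl => ?_⟩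
      fin_cases l
      · exact absurd rfl hl
      · exact h.2.1
      · exact h.2.2
    · refine Or.inr fun l => ?_
      fin_cases l
      · exact h.1
      · exact h.2.1
      · exact h.2.2
  refine sepWeight_meanOrdered_mixedK_le d a 0 hd hK hrows' (fun z hz j i hj hi hgi => ?_)
  -- the coefficient of the K = 3 identity is positive
  have key := sepWeight_meanOrder_of_ratioOrder d (a j) (a i) z
  have hc1 : 0 < ((d 1 : ℝ) - d 0) := sub_pos.mpr (by exact_mod_cast h01)
  have hc2 : 0 < ((d 2 : ℝ) - d 0) := sub_pos.mpr (by exact_mod_cast h02)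
  have hc3 : 0 < ((d 2 : ℝ) - d 1) := sub_pos.mpr (by exact_mod_cast h12)
  have hcoef : 0 < ((d 1 : ℝ) - d 0) * ((d 2 : ℝ) - d 0) * ((d 2 : ℝ) - d 1) * (z ^ (d 1) * z ^ (d 2)) := by positivity
  -- data on the unswitched incoherent row `i`
  have hi1 : a i 1 < 0 := hi 1 (by decide)
  have hi2 : a i 2 < 0 := hi 2 (by decide)
  have hgi' : 0 < a i 0 * z ^ (d 0) + a i 1 * z ^ (d 1) + a i 2 * z ^ (d 2) := by
    simpa only [Fin.sum_univ_three] using hgi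
  have hBi : (∑ l, ((d l : ℝ) - d 0) * a i l * z ^ (d l)) < 0 :=
    sepWeight_strippedRow_neg d (fun (_ : Fin 1) => a i) 0 hd hK (fun _ => ⟨?_, hi⟩) 0 hz
  swap
  · rcases hrows i with h | h
    · exact h.1
    · exact h.1
  rcases hrows j with h | h
  · -- `j` incoherent: it must be switched
    have hjsw : a j 0 * z ^ (d 0) + a j 1 * z ^ (d 1) + a j 2 * z ^ (d 2) < 0 := by
      rcases hj with hpos | hlt
      · exact absurd h.2.1 (not_lt.mpr (hpos 1).le)
      · simpa only [Fin.sum_univ_three] using hlt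
    have hle : a i 1 / a i 2 ≤ a j 1 / a j 2 := hord z hz j i (Or.inr hjsw) ⟨hi1, hi2⟩ hgi'
    -- product form: `a_{i1} a_{j2} ≤ a_{j1} a_{i2}` (both top letters negative)
    have hprod : a i 1 * a j 2 ≤ a j 1 * a i 2 := by
      rw [← neg_div_neg_eq (a i 1), ← neg_div_neg_eq (a j 1)] at hle
      have := (div_le_div_iff₀ (neg_pos.mpr hi2) (neg_pos.mpr h.2.2)).mp hle
      linarith
    have hBj : (∑ l, ((d l : ℝ) - d 0) * a j l * z ^ (d l)) < 0 :=
      sepWeight_strippedRow_neg d (fun (_ : Fin 1) => a j) 0 hd hK (fun _ => ⟨h.1, fun l hl => by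
        fin_cases l
        · exact absurd rfl hl
        · exact h.2.1
        · exact h.2.2⟩) 0 hz
    -- `B2_j/B1_j ≤ B2_i/B1_i` ⟸ `B2_i B1_j − B2_j B1_i ≥ 0` with `B1_i B1_j > 0`
    rw [← sub_nonneg, div_sub_div _ _ hBi.ne hBj.ne]
    refine div_nonneg ?_ (mul_pos_of_neg_of_neg hBi hBj).le
    have hkey' : (∑ l, ((d l : ℝ) - d 0) ^ 2 * a i l * z ^ (d l)) * (∑ l, ((d l : ℝ) - d 0) * a j l * z ^ (d l)) - (∑ l, ((d l : ℝ) - d 0) * a i l * z ^ (d l)) * (∑ l, ((d l : ℝ) - d 0) ^ 2 * a j l * z ^ (d l))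
        = -(((d 1 : ℝ) - d 0) * ((d 2 : ℝ) - d 0) * ((d 2 : ℝ) - d 1) * (z ^ (d 1) * z ^ (d 2))
          * (a i 1 * a j 2 - a j 1 * a i 2)) := by
      rw [← key]; ring
    rw [hkey']
    nlinarith
  · -- `j` one-signed
    have hle : a i 1 / a i 2 ≤ a j 1 / a j 2 := hord z hz j i (Or.inl ⟨h.2.1, h.2.2⟩) ⟨hi1, hi2⟩ hgi'
    -- product form: `a_{j1} a_{i2} ≤ a_{i1} a_{j2}` (top letters of opposite signs)
    have hprod : a j 1 * a i 2 ≤ a i 1 * a j 2 := by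
      rw [← neg_div_neg_eq (a i 1)] at hle
      have := (div_le_div_iff₀ (neg_pos.mpr hi2) h.2.2).mp hle
      linarith
    have hBj : 0 < (∑ l, ((d l : ℝ) - d 0) * a j l * z ^ (d l)) :=
      sepWeight_strippedRow_pos d (fun (_ : Fin 1) => a j) 0 hd hK 0 (fun l => by
        fin_cases l
        · exact h.1
        · exact h.2.1
        · exact h.2.2) hz
    -- `B2_j/B1_j ≤ B2_i/B1_i` ⟸ `B2_i B1_j − B1_i B2_j ≤ 0` with `B1_i B1_j < 0`
    rw [← sub_nonneg, div_sub_div _ _ hBi.ne hBj.ne']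
    refine div_nonneg_of_nonpos ?_ (mul_neg_of_neg_of_pos hBi hBj).le
    have hkey' : (∑ l, ((d l : ℝ) - d 0) ^ 2 * a i l * z ^ (d l)) * (∑ l, ((d l : ℝ) - d 0) * a j l * z ^ (d l)) - (∑ l, ((d l : ℝ) - d 0) * a i l * z ^ (d l)) * (∑ l, ((d l : ℝ) - d 0) ^ 2 * a j l * z ^ (d l))
        = -(((d 1 : ℝ) - d 0) * ((d 2 : ℝ) - d 0) * ((d 2 : ℝ) - d 1) * (z ^ (d 1) * z ^ (d 2))
          * (a i 1 * a j 2 - a j 1 * a i 2)) := by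
      rw [← key]; ring
    rw [hkey']
    nlinarith

end ProductPlusOne

end Summit.ValiantsHypothesis.ValiantsHypothesis.Theorems.LacunarySymmetroidMatrixDescartes
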